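import Summits.ValiantsHypothesis.ValiantsHypothesis.Theorems.KPlusLogSqLawTropicalBLocalPatternLaw

/-!
# Route «KPlusLogSqLaw», crux `TropicalB` (stmt-ValiantsHypothesis-19771) — THE THIN STUB HOLDS FOR CHAINS WITH LOGARITHMIC EXCHANGE CYCLES:
# `K ≤ ⌊log₂ m⌋²` and every exchange cycle of `≤ ⌊log₂ m⌋` columns ⇒ `n ≤ 2^(8·⌊log₂ m⌋²)`, in EVERY design

HONEST FRAMING.  Helper toward the registered stub `stub_tropThin` (`∃ C, ∀ m K, K ≤ ⌊log₂ m⌋² → TropRow m K (2^(C·⌊log₂ m⌋²))`, ⟺ `TropicalB`) of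
`Cruxes/TropicalB/Lines/birth.lean` (crux `Summit.ValiantsHypothesis.ValiantsHypothesis.Theses.KPlusLogSqLaw.TropicalB`, item stmt-ValiantsHypothesis-19771,
route KPlusLogSqLaw; cell `pub-symmetroid`, seat val-sym-trop-p1 g25, 2026-08-29; `--supports … --as helper`).  A SECTOR theorem of the thin stub for
ARBITRARY designs and exponents: it proves the stub's inequality (with `C = 8`, unsigned) for the chains whose exchange quotients have all orbits of at most
`⌊log₂ m⌋` columns, and says nothing about chains with longer cycles — the stub and `TropicalB` stay OPEN; nothing here bears on `WeakLifting`, DoorA26 /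
DoorA34, `MatrixDescartes` (stmt-ValiantsHypothesis-18050) or VP ≠ VNP.

From the LOCAL PATTERN LAW (`LocalPattern.chain_le_localPattern`, this seat: `n ≤ #J + Σ_{ℓ ≤ c} C(m,ℓ)²·multichoose(K,ℓ)`):

* `sum_sites_le` — `Σ_{ℓ ≤ c} C(m,ℓ)²·multichoose(K,ℓ) ≤ (c+1)·(m²(K+c) + 1)^c` (so bounded cycles are polynomial, and cycles of `c` columns cost
  `2^{O(c·log(m²(K+c)))}`).
* `thin_arith` — for `L = ⌊log₂ m⌋ ≥ 1` and `K ≤ L²`: `(L+1)·(m²(K+L) + 1)^L ≤ 2^(8L²)`.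
* **`chain_le_thin_logCycles_of_exceptions`** — `K ≤ ⌊log₂ m⌋²` ⇒ every unsigned dominant chain of every design of format `(m, K)` has
  `n ≤ #J + 2^(8·⌊log₂ m⌋²)` for every set `J` of steps outside which all orbits have `≤ ⌊log₂ m⌋` columns; **`chain_le_thin_logCycles`** (`J = ∅`):
  the thin stub's inequality with `C = 8` for every chain whose exchange cycles have at most `⌊log₂ m⌋` columns.
READING.  In the thin window the crux is EXACTLY the statement that the steps exchanging along cycles LONGER than `log₂ m` are also `2^{O(log² m)}` in number:
a counterexample to `stub_tropThin` must contain super-quasi-polynomially many exchanges along cycles of more than `⌊log₂ m⌋` columns (for comparison: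
bounded cycles are polynomial, `…LocalPatternLaw`; the Hessenberg / path sector has arbitrarily long cycles and is inside TB by Gusfield's recursion).
[this cell's law + arithmetic]
-/

set_option linter.dupNamespace false
set_option autoImplicit false

namespace Summit.ValiantsHypothesis.ValiantsHypothesis.Theorems.KPlusLogSqLaw

open Summit.ValiantsHypothesis.ValiantsHypothesis.Theorems.MatrixDescartes.Negative
open scoped BigOperators
open Finset

namespace LocalPattern

/-- **Bounded cycles are polynomial, closed form**: `Σ_{ℓ ≤ c} C(m,ℓ)²·multichoose(K,ℓ) ≤ (c+1)·(m²(K+c) + 1)^c`. [arithmetic] -/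
theorem sum_sites_le (m K c : ℕ) :
    ∑ ℓ ∈ range (c + 1), (m.choose ℓ) ^ 2 * Nat.multichoose K ℓ ≤ (c + 1) * (m ^ 2 * (K + c) + 1) ^ c := by
  have hterm : ∀ ℓ ∈ range (c + 1), (m.choose ℓ) ^ 2 * Nat.multichoose K ℓ ≤ (m ^ 2 * (K + c) + 1) ^ c := by
    intro ℓ hℓ
    have hℓc : ℓ ≤ c := Nat.lt_succ_iff.mp (mem_range.mp hℓ)
    have h1 : m.choose ℓ ≤ m ^ ℓ := Nat.choose_le_pow _ _
    have h2 : Nat.multichoose K ℓ ≤ (K + c) ^ ℓ := by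
      rw [Nat.multichoose_eq]
      calc (K + ℓ - 1).choose ℓ ≤ (K + ℓ - 1) ^ ℓ := Nat.choose_le_pow _ _
        _ ≤ (K + c) ^ ℓ := Nat.pow_le_pow_left (by omega) ℓ
    calc (m.choose ℓ) ^ 2 * Nat.multichoose K ℓ ≤ (m ^ ℓ) ^ 2 * (K + c) ^ ℓ := Nat.mul_le_mul (Nat.pow_le_pow_left h1 2) h2
      _ = (m ^ 2 * (K + c)) ^ ℓ := by rw [mul_pow, ← pow_mul, ← pow_mul, mul_comm ℓ 2]
      _ ≤ (m ^ 2 * (K + c) + 1) ^ ℓ := Nat.pow_le_pow_left (Nat.le_succ _) ℓ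
      _ ≤ (m ^ 2 * (K + c) + 1) ^ c := Nat.pow_le_pow_right (Nat.succ_pos _) hℓc
  calc ∑ ℓ ∈ range (c + 1), (m.choose ℓ) ^ 2 * Nat.multichoose K ℓ ≤ ∑ _ℓ ∈ range (c + 1), (m ^ 2 * (K + c) + 1) ^ c := sum_le_sum hterm
    _ = (c + 1) * (m ^ 2 * (K + c) + 1) ^ c := by rw [sum_const, card_range, smul_eq_mul]

/-- **Thin-window arithmetic**: for `L = ⌊log₂ m⌋ ≥ 1` and `K ≤ L²`, `(L+1)·(m²(K+L) + 1)^L ≤ 2^(8L²)`. [arithmetic] -/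
theorem thin_arith (m K : ℕ) (hL : 1 ≤ Nat.log 2 m) (hK : K ≤ Nat.log 2 m ^ 2) :
    (Nat.log 2 m + 1) * (m ^ 2 * (K + Nat.log 2 m) + 1) ^ Nat.log 2 m ≤ 2 ^ (8 * Nat.log 2 m ^ 2) := by
  set L := Nat.log 2 m with hLdef
  have hm : m < 2 ^ (L + 1) := Nat.lt_pow_succ_log_self (by norm_num) m
  -- `m² ≤ 2^(2L+2)`, `K + L ≤ L² + L ≤ 4^L`, `L + 1 ≤ 2^L`
  have hm2 : m ^ 2 ≤ 2 ^ (2 * L + 2) := by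
    calc m ^ 2 ≤ (2 ^ (L + 1)) ^ 2 := Nat.pow_le_pow_left hm.le 2
      _ = 2 ^ (2 * L + 2) := by rw [← pow_mul]; ring_nf
  have hL1 : L + 1 ≤ 2 ^ L := Nat.lt_two_pow_self
  have hKL : K + L ≤ 2 ^ (2 * L) := by
    have h1 : K + L ≤ L ^ 2 + L := by omega
    have h2 : L ^ 2 + L ≤ 2 ^ (2 * L) := by
      have h3 : L ≤ 2 ^ L := Nat.lt_two_pow_self.le
      have h4 : (2 : ℕ) ^ (2 * L) = 2 ^ L * 2 ^ L := by rw [two_mul, pow_add]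
      rw [h4]
      have h5 : 1 ≤ 2 ^ L := Nat.one_le_two_pow
      nlinarith
    exact h1.trans h2
  have hbase : m ^ 2 * (K + L) + 1 ≤ 2 ^ (4 * L + 3) := by
    calc m ^ 2 * (K + L) + 1 ≤ 2 ^ (2 * L + 2) * 2 ^ (2 * L) + 1 := by
          have := Nat.mul_le_mul hm2 hKL; omega
      _ = 2 ^ (4 * L + 2) + 1 := by rw [← pow_add]; ring_nf
      _ ≤ 2 ^ (4 * L + 2) + 2 ^ (4 * L + 2) := by have := Nat.one_le_two_pow (n := 4 * L + 2); omega
      _ = 2 ^ (4 * L + 3) := by rw [pow_succ]; ring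
  calc (L + 1) * (m ^ 2 * (K + L) + 1) ^ L ≤ 2 ^ L * (2 ^ (4 * L + 3)) ^ L := Nat.mul_le_mul hL1 (Nat.pow_le_pow_left hbase L)
    _ = 2 ^ (L + (4 * L + 3) * L) := by rw [← pow_mul, ← pow_add]
    _ ≤ 2 ^ (8 * L ^ 2) := Nat.pow_le_pow_right (by norm_num) (by nlinarith)

variable {m K : ℕ} (d : Fin K → ℕ) (v ε : Fin m → Fin m → Fin K → ℤ)

/-- **THIN STUB FOR LOG-CYCLE CHAINS, with exceptions.**  If `K ≤ ⌊log₂ m⌋²` then in every design of format `(m, K)` every chain of terms dominant at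
strictly increasing slopes with consecutive terms distinct has `n ≤ #J + 2^(8·⌊log₂ m⌋²)` for every set `J` of steps outside which every column lies in
an invariant set of at most `⌊log₂ m⌋` columns of the exchange quotient. [this cell's law] -/
theorem chain_le_thin_logCycles_of_exceptions (hK : K ≤ Nat.log 2 m ^ 2) {n : ℕ} (θ : Fin (n + 1) → ℤ)
    (p : Fin (n + 1) → Equiv.Perm (Fin m) × (Fin m → Fin K))
    (hθ : StrictMono θ) (hdom : ∀ k, IsDominant d v ε (θ k) (p k)) (hne : ∀ k : Fin n, p k.castSucc ≠ p k.succ)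
    (J : Finset (Fin n))
    (horb : ∀ k : Fin n, k ∉ J → ∀ b : Fin m, ∃ T : Finset (Fin m), b ∈ T ∧ T.card ≤ Nat.log 2 m ∧
      ∀ x, ((p k.castSucc).1⁻¹ * (p k.succ).1) x ∈ T ↔ x ∈ T) :
    n ≤ J.card + 2 ^ (8 * Nat.log 2 m ^ 2) := by
  have hlaw := chain_le_localPattern d v ε (Nat.log 2 m) θ p hθ hdom hne J horb
  rcases Nat.eq_zero_or_pos (Nat.log 2 m) with hL | hL
  · -- `⌊log₂ m⌋ = 0`: then `K = 0`, so `m = 0` (no class map otherwise) and the chain has one term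
    rw [hL] at hK
    have hK0 : K = 0 := by omega
    subst hK0
    rcases Nat.eq_zero_or_pos m with hm | hm
    · have hn0 : n = 0 := by
        rcases Nat.eq_zero_or_pos n with h | h
        · exact h
        · exfalso
          exact hne ⟨0, h⟩ (Prod.ext (Equiv.ext fun b => absurd b.isLt (by omega)) (funext fun b => absurd b.isLt (by omega)))
      calc n = 0 := hn0
        _ ≤ _ := Nat.zero_le _
    · exact absurd ((p 0).2 ⟨0, hm⟩).isLt (Nat.not_lt_zero _)
  · have h := (sum_sites_le m K (Nat.log 2 m)).trans (thin_arith m K hL hK)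
    omega

/-- **THE THIN STUB HOLDS FOR CHAINS WITH LOGARITHMIC EXCHANGE CYCLES** (`C = 8`, unsigned, every design): if `K ≤ ⌊log₂ m⌋²` and every exchange
quotient of the chain has all orbits of at most `⌊log₂ m⌋` columns, then `n ≤ 2^(8·⌊log₂ m⌋²)`. [this cell's law] -/
theorem chain_le_thin_logCycles (hK : K ≤ Nat.log 2 m ^ 2) {n : ℕ} (θ : Fin (n + 1) → ℤ)
    (p : Fin (n + 1) → Equiv.Perm (Fin m) × (Fin m → Fin K))
    (hθ : StrictMono θ) (hdom : ∀ k, IsDominant d v ε (θ k) (p k)) (hne : ∀ k : Fin n, p k.castSucc ≠ p k.succ)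
    (horb : ∀ k : Fin n, ∀ b : Fin m, ∃ T : Finset (Fin m), b ∈ T ∧ T.card ≤ Nat.log 2 m ∧
      ∀ x, ((p k.castSucc).1⁻¹ * (p k.succ).1) x ∈ T ↔ x ∈ T) :
    n ≤ 2 ^ (8 * Nat.log 2 m ^ 2) := by
  have h := chain_le_thin_logCycles_of_exceptions d v ε hK θ p hθ hdom hne ∅ (fun k _ b => horb k b)
  simpa using h

/-- **Sign-alternating form** (the hypothesis list of `TropRow` / `TropicalCensus.TropRootLawAt`). [this cell's law] -/
theorem chain_le_thin_logCycles_alt (hK : K ≤ Nat.log 2 m ^ 2) {n : ℕ} (θ : Fin (n + 1) → ℤ)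
    (p : Fin (n + 1) → Equiv.Perm (Fin m) × (Fin m → Fin K))
    (hθ : StrictMono θ) (hdom : ∀ k, IsDominant d v ε (θ k) (p k))
    (halt : ∀ k : Fin n, termSign ε (p k.castSucc) * termSign ε (p k.succ) < 0)
    (horb : ∀ k : Fin n, ∀ b : Fin m, ∃ T : Finset (Fin m), b ∈ T ∧ T.card ≤ Nat.log 2 m ∧
      ∀ x, ((p k.castSucc).1⁻¹ * (p k.succ).1) x ∈ T ↔ x ∈ T) :
    n ≤ 2 ^ (8 * Nat.log 2 m ^ 2) :=
  chain_le_thin_logCycles d v ε hK θ p hθ hdom (ne_succ_of_alternating ε p halt) horb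

end LocalPattern

end Summit.ValiantsHypothesis.ValiantsHypothesis.Theorems.KPlusLogSqLaw
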